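import Literature.MathematicalPhysics.QuantumFieldTheory.Balaban1983to89.BlockAveragingPlaquetteBound
import Summits.QuantumFields.YangMills.Theorems.SmallFieldWideningLargeFieldMassRefinementTailLocalWordStokes
import HarnessLib

/-!
# Route `SmallFieldWidening`, crux r3 `LargeFieldMassRefinementTail` (stmt-QuantumFields-22884) — support file:
# [Balaban1985Averaging] PROP 1 IN CRUDE FORM FOR THE (0.4) AVERAGING ON `SU(N)` UNDER A **LOCAL** SMALL-FIELD HYPOTHESIS

Width seat `ym-line-sfw-p2-w2` (gen 47).  The tree's `BlockAveragingPlaquetteBound.dist1_plaqHol_avgFun_lt` bounds ONE coarse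
plaquette `p′` of the (0.4)-averaged field `Ū = avgFun ℰp U` by `(L² + 6((d+2)L)²)·a` under the GLOBAL hypothesis `PlaqSmall a U`.
Its proof only meets fine plaquettes near `p′`: the `L × L` square of the straight transporters (`B10Eq47AxialChi.dist1_plaqHol_axialAvg_le`,
already local) and the (0.4) loop words at the four bonds of `p′` (closed words of length `≤ (d+2)L` from the block centres `emb p′₋`,
`emb (p′₋ + e_μ)`, `emb (p′₋ + e_ν)`).  This module states the bound under the LOCAL hypothesis of
`…LocalWordStokes` at the block centre `emb p′₋` with radius `R ≥ (d+3)L`: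
* §1 straight walks: `walkEnd x (+e_μ)^n = shiftN x μ n`; the local hypothesis moves from `emb y` to `emb (y + e_μ)` at the cost of
  `L` letters (`walkEnd_replicate_L`);
* §2 **`dist1_corr_le_loc`** (the correction factor at a bond `c` is within `6t`, `t = (((d+2)L)²/4)·a < δ_N`, of `1` under the local
  hypothesis at `emb c₋`, radius `≥ (d+2)L`) and **`dist1_plaqHol_avgFun_lt_loc`** / **`dist1_plaqHol_blockAvg_lt_loc`**:
  `|Ū(∂p′) − 1| < (L² + 6((d+2)L)²)·a` under the local hypothesis at `emb p′₋` with radius `≥ (d+3)L` (standing range `j + 1 ≤ m + K`);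
* §3 **`loc_of_box`**: the local hypothesis in WORD form follows from its BOX form «every plaquette cornered at `emb p′₋ + e`,
  `e ∈ ℤ^d`, `|e_ν| ≤ R`, is within `a` of `1`» (`walkEnd_apply`, `|netDisp u| ≤ |u|`) — the form a union bound enumerates.
Nothing here is new mathematics ([Balaban1985Averaging] (19)–(20), (26)–(27), Prop 1 (51); the tree file's argument); the point is
the hypothesis.  No summit is proved by this file (rung R3 is a RECORD rung; the YM mass gap is NOT proved by any of this).
-/

noncomputable section

namespace Summit.QuantumFields.YangMills.Theorems.LocalAveragedPlaquette

open Literature.MathematicalPhysics.QuantumFieldTheory.Balaban1983to89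
open Literature.MathematicalPhysics.QuantumFieldTheory.Balaban1983to89.T4Continuum
open Literature.MathematicalPhysics.QuantumFieldTheory.Balaban1983to89.T4ReflectionCone
open Literature.MathematicalPhysics.QuantumFieldTheory.Balaban1983to89.BlockAveraging
open Literature.MathematicalPhysics.QuantumFieldTheory.Balaban1983to89.ExpMeanLog
open Literature.MathematicalPhysics.QuantumFieldTheory.Balaban1983to89.BlockAveragingPlaquetteBound
open Literature.MathematicalPhysics.QuantumFieldTheory.Balaban1983to89.B10Eq47AxialChi (shiftN shiftN_succ dist1_plaqHol_axialAvg_le)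
open Summit.QuantumFields.YangMills.Theorems.LocalWordStokes

variable {P : Params} {j : ℕ} {G : Type*} [GaugeGroup G]

/-! ## §1 Straight walks; moving the local hypothesis between block centres -/

/-- `shiftN (x + e_μ) μ n = (shiftN x μ n) + e_μ`. [folklore] -/
private theorem shiftN_shift_self (x : Site P j) (μ : Fin P.d) : ∀ n : ℕ, shiftN (x.shift μ) μ n = (shiftN x μ n).shift μ
  | 0 => rfl
  | n + 1 => by rw [shiftN_succ, shiftN_shift_self x μ n, shiftN_succ]

/-- The straight walk of `n` letters `+e_μ` from `x` ends at `shiftN x μ n`. [folklore] -/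
theorem walkEnd_replicate_eq_shiftN (μ : Fin P.d) : ∀ (n : ℕ) (x : Site P j),
    walkEnd x (List.replicate n (μ, true)) = shiftN x μ n
  | 0, _ => rfl
  | n + 1, x => by
    rw [List.replicate_succ, shiftN_succ, ← shiftN_shift_self]
    exact walkEnd_replicate_eq_shiftN μ n (x.shift μ)

/-- **MOVING THE LOCAL HYPOTHESIS TO THE NEXT BLOCK CENTRE**: the local hypothesis at `emb y` with radius `R ≥ L + r` gives the local
hypothesis at `emb (y + e_μ)` with radius `r` (`emb (y + e_μ) = walkEnd (emb y) (+e_μ)^L`). [cite: Balaban1987RG1, (0.1) p.252] -/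
theorem loc_shift {δ : ℝ} {U : GaugeField P j G} (y : Site P (j + 1)) (μ : Fin P.d) {R r : ℕ} (hRr : P.L + r ≤ R)
    (hU : ∀ u : List (Letter P.d), u.length ≤ R → ∀ (a b : Fin P.d) (hab : a < b),
      dist1 (GaugeField.plaqHol U ⟨walkEnd (emb y) u, a, b, hab⟩) < δ) :
    ∀ u : List (Letter P.d), u.length ≤ r → ∀ (a b : Fin P.d) (hab : a < b),
      dist1 (GaugeField.plaqHol U ⟨walkEnd (emb (y.shift μ)) u, a, b, hab⟩) < δ := by
  intro u hu a b hab
  rw [← walkEnd_replicate_L, ← walkEnd_append]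
  exact hU _ (by rw [List.length_append, List.length_replicate]; omega) a b hab

/-! ## §2 The correction factors and the coarse plaquette under the local hypothesis -/

section Main

open scoped Matrix.Norms.L2Operator

variable {n : Type*} [Fintype n] [DecidableEq n] [Nonempty n]

/-- **THE CORRECTION FACTOR IS CLOSE TO `1` ON LOCALLY SMALL FIELDS**: if every plaquette cornered at `walkEnd (emb c₋) u`,
`|u| ≤ r`, `r ≥ (d+2)L`, is within `a ≥ 0` of `1` and `t := (((d+2)L)²/4)·a < δ_N`, then `dist1 (corr ℰp U c) ≤ 6t` (the guard
holds by `small_loc`, every loop variable is within `t` of `1` by `dist1_loopHol_le_loc`, then [Balaban1985Averaging] (26)–(27)).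
[cite: Balaban1987RG1, (0.4) p.253] -/
theorem dist1_corr_le_loc {a : ℝ} (ha : 0 ≤ a) {U : GaugeField P j (Matrix.specialUnitaryGroup n ℂ)} (c : PBond P (j + 1))
    {r : ℕ} (hr : (P.d + 2) * P.L ≤ r)
    (hU : ∀ u : List (Letter P.d), u.length ≤ r → ∀ (a' b' : Fin P.d) (hab : a' < b'),
      dist1 (GaugeField.plaqHol U ⟨walkEnd (emb c.src) u, a', b', hab⟩) < a)
    (ht : ((((P.d + 2) * P.L : ℕ) : ℝ) ^ 2 / 4) * a < deltaSU n) :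
    dist1 (corr (expMeanLogSU (n := n)) U c) ≤ 6 * (((((P.d + 2) * P.L : ℕ) : ℝ) ^ 2 / 4) * a) := by
  have hsmall : Small (expMeanLogSU (n := n)) U c := small_loc _ ha c hr hU ht
  unfold corr
  rw [if_pos hsmall]
  exact dist1_expMeanLogSU_avg_le (fun i => dist1_loopHol_le_loc ha c hr hU i) ht

/-- **THE STRAIGHT TRANSPORTERS' SQUARE UNDER THE LOCAL HYPOTHESIS**: `|U(∂R_{L,L}(emb p′₋)) − 1| < L²·a` if every plaquette
cornered at `walkEnd (emb p′₋) u`, `|u| ≤ r`, `r ≥ 2L`, is within `a` of `1` (the `L × L` plaquettes of the square are cornered at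
`emb p′₋ + t e_ν + s e_μ`, `s, t < L`; standing range). [cite: Balaban1985Averaging, (9)–(10) p.19 + (19) p.21] -/
theorem dist1_plaqHol_axialAvg_lt_loc (hj : j + 1 ≤ P.m + P.K) {a : ℝ} {U : GaugeField P j G} (p : Plaq P (j + 1)) {r : ℕ}
    (hr : 2 * P.L ≤ r)
    (hU : ∀ u : List (Letter P.d), u.length ≤ r → ∀ (a' b' : Fin P.d) (hab : a' < b'),
      dist1 (GaugeField.plaqHol U ⟨walkEnd (emb p.src) u, a', b', hab⟩) < a) :
    dist1 (GaugeField.plaqHol (AveragingRT.axialAvg U) p) < (P.L : ℝ) ^ 2 * a := by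
  refine (dist1_plaqHol_axialAvg_le hj U p).trans_lt ?_
  have hL : (Finset.range P.L).Nonempty := Finset.nonempty_range_iff.mpr (ne_of_gt P.L_pos)
  have hterm : ∀ t ∈ Finset.range P.L, ∀ s ∈ Finset.range P.L,
      dist1 (GaugeField.plaqHol U ⟨shiftN (shiftN (emb p.src) p.ν t) p.μ s, p.μ, p.ν, p.hμν⟩) < a := by
    intro t ht s hs
    rw [Finset.mem_range] at ht hs
    have h := hU (List.replicate t (p.ν, true) ++ List.replicate s (p.μ, true))
      (by rw [List.length_append, List.length_replicate, List.length_replicate]; omega) p.μ p.ν p.hμν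
    rwa [walkEnd_append, walkEnd_replicate_eq_shiftN, walkEnd_replicate_eq_shiftN] at h
  calc ∑ t ∈ Finset.range P.L, ∑ s ∈ Finset.range P.L,
          dist1 (GaugeField.plaqHol U ⟨shiftN (shiftN (emb p.src) p.ν t) p.μ s, p.μ, p.ν, p.hμν⟩)
      < ∑ _t ∈ Finset.range P.L, ∑ _s ∈ Finset.range P.L, a :=
        Finset.sum_lt_sum_of_nonempty hL fun t ht => Finset.sum_lt_sum_of_nonempty hL fun s hs => hterm t ht s hs
    _ = (P.L : ℝ) ^ 2 * a := by simp [Finset.sum_const, Finset.card_range]; ring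

/-- **THE COARSE PLAQUETTE OF THE (0.4)-AVERAGED FIELD UNDER THE LOCAL HYPOTHESIS** (`SU(N)`, printed `exp[mean log]`, standing
range `j + 1 ≤ m + K`): if every plaquette of `U` cornered at `walkEnd (emb p′₋) u`, `|u| ≤ R`, `R ≥ (d+3)L`, is within `a ≥ 0` of `1`
and `(((d+2)L)²/4)·a < δ_N`, then `|Ū(∂p′) − 1| < (L² + 6((d+2)L)²)·a` for `Ū = avgFun ℰp U` — the square of straight transporters
(`< L²a`) plus the four correction factors at the bonds of `p′` (block centres `emb p′₋`, `emb(p′₋ + e_μ)`, `emb(p′₋ + e_ν)`, each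
`≤ 6t`). [cite: Balaban1985Averaging, Prop. 1 (51) p.26; Balaban1987RG1, (0.4) p.253] -/
theorem dist1_plaqHol_avgFun_lt_loc (hj : j + 1 ≤ P.m + P.K) {a : ℝ} (ha : 0 ≤ a)
    {U : GaugeField P j (Matrix.specialUnitaryGroup n ℂ)} (p : Plaq P (j + 1)) {R : ℕ} (hR : (P.d + 3) * P.L ≤ R)
    (hU : ∀ u : List (Letter P.d), u.length ≤ R → ∀ (a' b' : Fin P.d) (hab : a' < b'),
      dist1 (GaugeField.plaqHol U ⟨walkEnd (emb p.src) u, a', b', hab⟩) < a)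
    (ht : ((((P.d + 2) * P.L : ℕ) : ℝ) ^ 2 / 4) * a < deltaSU n) :
    dist1 (GaugeField.plaqHol (avgFun (expMeanLogSU (n := n)) U) p) <
      ((P.L : ℝ) ^ 2 + 6 * (((P.d + 2) * P.L : ℕ) : ℝ) ^ 2) * a := by
  have hR2 : (P.d + 2) * P.L ≤ R := le_trans (Nat.mul_le_mul_right _ (by omega)) hR
  have hRL : P.L + (P.d + 2) * P.L ≤ R := by
    have : (P.d + 3) * P.L = P.L + (P.d + 2) * P.L := by ring
    omega
  have h2L : 2 * P.L ≤ R := le_trans (Nat.mul_le_mul_right _ (by omega)) hR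
  have hax := dist1_plaqHol_axialAvg_lt_loc hj p h2L hU
  -- the four correction factors
  have h1 := dist1_corr_le_loc (n := n) ha ⟨p.src, p.μ⟩ hR2 hU ht
  have h4 := dist1_corr_le_loc (n := n) ha ⟨p.src, p.ν⟩ hR2 hU ht
  have h2 := dist1_corr_le_loc (n := n) ha ⟨p.src.shift p.μ, p.ν⟩ le_rfl (loc_shift p.src p.μ hRL hU) ht
  have h3 := dist1_corr_le_loc (n := n) ha ⟨p.src.shift p.ν, p.μ⟩ le_rfl (loc_shift p.src p.ν hRL hU) ht
  have hins := dist1_plaquette_with_corr_le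
    (corr (expMeanLogSU (n := n)) U ⟨p.src, p.μ⟩) (AveragingRT.axialAvg U ⟨p.src, p.μ⟩)
    (corr (expMeanLogSU (n := n)) U ⟨p.src.shift p.μ, p.ν⟩) (AveragingRT.axialAvg U ⟨p.src.shift p.μ, p.ν⟩)
    (corr (expMeanLogSU (n := n)) U ⟨p.src.shift p.ν, p.μ⟩) (AveragingRT.axialAvg U ⟨p.src.shift p.ν, p.μ⟩)
    (corr (expMeanLogSU (n := n)) U ⟨p.src, p.ν⟩) (AveragingRT.axialAvg U ⟨p.src, p.ν⟩)
  have hax' : dist1 (AveragingRT.axialAvg U ⟨p.src, p.μ⟩ * AveragingRT.axialAvg U ⟨p.src.shift p.μ, p.ν⟩ *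
      (AveragingRT.axialAvg U ⟨p.src.shift p.ν, p.μ⟩)⁻¹ * (AveragingRT.axialAvg U ⟨p.src, p.ν⟩)⁻¹) < (P.L : ℝ) ^ 2 * a := hax
  show dist1 (corr _ U ⟨p.src, p.μ⟩ * AveragingRT.axialAvg U ⟨p.src, p.μ⟩ *
      (corr _ U ⟨p.src.shift p.μ, p.ν⟩ * AveragingRT.axialAvg U ⟨p.src.shift p.μ, p.ν⟩) *
      (corr _ U ⟨p.src.shift p.ν, p.μ⟩ * AveragingRT.axialAvg U ⟨p.src.shift p.ν, p.μ⟩)⁻¹ *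
      (corr _ U ⟨p.src, p.ν⟩ * AveragingRT.axialAvg U ⟨p.src, p.ν⟩)⁻¹) < _
  nlinarith

/-- **[Balaban1985Averaging] PROP 1, CRUDE FORM, LOCAL HYPOTHESIS — for the tree's total averaging `blockAvg ℰp`** (whose `avg` IS
`avgFun ℰp`): `|(blockAvg ℰp U)(∂p′) − 1| < (L² + 6((d+2)L)²)·a` under the local hypothesis at `emb p′₋` with radius `≥ (d+3)L`.
[cite: Balaban1985Averaging, Prop. 1 (51) p.26; Balaban1987RG1, (0.4) p.253] -/
theorem dist1_plaqHol_blockAvg_lt_loc (hj : j + 1 ≤ P.m + P.K) {a : ℝ} (ha : 0 ≤ a)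
    {U : GaugeField P j (Matrix.specialUnitaryGroup n ℂ)} (p : Plaq P (j + 1)) {R : ℕ} (hR : (P.d + 3) * P.L ≤ R)
    (hU : ∀ u : List (Letter P.d), u.length ≤ R → ∀ (a' b' : Fin P.d) (hab : a' < b'),
      dist1 (GaugeField.plaqHol U ⟨walkEnd (emb p.src) u, a', b', hab⟩) < a)
    (ht : ((((P.d + 2) * P.L : ℕ) : ℝ) ^ 2 / 4) * a < deltaSU n) :
    dist1 (GaugeField.plaqHol ((blockAvg (expMeanLogSU (n := n))).avg U) p) <
      ((P.L : ℝ) ^ 2 + 6 * (((P.d + 2) * P.L : ℕ) : ℝ) ^ 2) * a :=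
  dist1_plaqHol_avgFun_lt_loc hj ha p hR hU ht

end Main

/-! ## §3 The box form of the local hypothesis -/

/-- `|netDisp u ν| ≤ |u|`: a word displaces by at most its length in every direction. [folklore] -/
theorem abs_netDisp_le_length (ν : Fin P.d) : ∀ u : List (Letter P.d), |netDisp u ν| ≤ u.length
  | [] => by simp [netDisp]
  | l :: u => by
    rw [netDisp_cons, List.length_cons, Nat.cast_succ]
    have ih := abs_netDisp_le_length ν u
    have hl : |(if l.1 = ν then (if l.2 then (1 : ℤ) else -1) else 0)| ≤ 1 := by
      split_ifs <;> simp
    calc |(if l.1 = ν then (if l.2 then (1 : ℤ) else -1) else 0) + netDisp u ν|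
        ≤ |(if l.1 = ν then (if l.2 then (1 : ℤ) else -1) else 0)| + |netDisp u ν| := abs_add_le _ _
      _ ≤ (u.length : ℤ) + 1 := by linarith

/-- **BOX FORM ⇒ WORD FORM.**  If every plaquette cornered at a site `x + e` with `e ∈ ℤ^d`, `|e_ν| ≤ R` (coordinates modulo the
period), is within `δ` of `1`, then so is every plaquette cornered at `walkEnd x u`, `|u| ≤ R` (`walkEnd x u = x + netDisp u`,
`|netDisp u| ≤ |u|`). [folklore] -/
theorem loc_of_box {δ : ℝ} {U : GaugeField P j G} (x : Site P j) (R : ℕ)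
    (hB : ∀ e : Fin P.d → ℤ, (∀ ν, |e ν| ≤ R) → ∀ (a b : Fin P.d) (hab : a < b),
      dist1 (GaugeField.plaqHol U ⟨fun ν => x ν + ((e ν : ℤ) : ZMod (P.sitesPerDir j)), a, b, hab⟩) < δ) :
    ∀ u : List (Letter P.d), u.length ≤ R → ∀ (a b : Fin P.d) (hab : a < b),
      dist1 (GaugeField.plaqHol U ⟨walkEnd x u, a, b, hab⟩) < δ := by
  intro u hu a b hab
  have hx : walkEnd x u = fun ν => x ν + ((netDisp u ν : ℤ) : ZMod (P.sitesPerDir j)) := funext (walkEnd_apply x u)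
  rw [hx]
  exact hB (fun ν => netDisp u ν) (fun ν => (abs_netDisp_le_length ν u).trans (by exact_mod_cast hu)) a b hab

end Summit.QuantumFields.YangMills.Theorems.LocalAveragedPlaquette

end
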